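import Summits.Ventures.CertifiedManyBodySolver.Observables.PairLROTowerChargedCells
import Summits.Ventures.CertifiedManyBodySolver.Observables.PairLROTowerChargedBracket
import HarnessLib

/-!
# OP1-C, part 6: the GRID-POINT cell consumer — one certificate per cell at its grid point, with the
# cell's interval slack, over a cover of the certified bracket `[μ₋(n), μ₊(n)]`, gives the pair-LRO leaf

HONEST FRAMING: first certified bounds on pairing observables; not a superconductivity verdict; a ceiling
route, never presence. Crew hubbard-obs (D-0042), seat hubbard-obs-lit (`literature-prover-hubbard-obs-lit-g7-0`);
the envelope wrapper booked by hubbard-obs RULINGS (eu) d187 «(A3)» / (ex4) d190 «(R5)», built — as asked by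
seat hubbard-obs-p1 (STATUS 23:11:28Z) and sr-mbsolver-menu-3 (CROSS-CELL 23:26:23Z (R5)) — ON the grid-point
theorem `liminf_pairFieldLRO_le_sq_of_onePoint_chargedStationary_bound_TT'_near` (PairLROTowerChargedBracket):
the interval slack is NOT re-derived here. Zero compute; no definition; no named fact; no number; no `sorry`.

The Stage-B producer certifies, for each cell of a chemical-potential grid, ONE charged one-point node with
its charged rows written at the cell's GRID POINT `μ'_j`, and supplies the cell's half-width `Δ_j` and the
one-point charge size `C_{q,j}` of its word (`hWq`, a theorem per word: PairLROTowerChargedWords /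
PairLROTowerChargedNumber; operator-norm convention (ex1)). By `…_near`, such a node bounds the pair-LRO
`liminf` by `(c_j − Δ_j C_{q,j} − A_j + (Σ_σ μ_{jσ})(n/2 − ν_j))²` as soon as SOME supporting slope
`μ_s ∈ [μ₋(n), μ₊(n)]` is within `Δ_j` of `μ'_j`. Since `μ₋(n) ≤ μ₊(n)` (`chemPotMinusTT'_le_chemPotPlusTT'`)
and the certified chords give `μ_lo ≤ μ₋(n)`, `μ₊(n) ≤ μ_hi` (`chemPot_mem_cell_of_mem_Icc`), any family of
grid cells `[μ'_j − Δ_j, μ'_j + Δ_j]` COVERING `[μ_lo, μ_hi]` contains one with `|μ'_j − μ₋(n)| ≤ Δ_j`, and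
the leaf holds at the MAXIMUM over the family (sr-mbsolver-menu-3 MENU3-TLPINCER §7.3 «μ-grid with interval
slack»). Three forms:

* §1 `liminf_pairFieldLRO_le_of_onePoint_chargedStationary_gridCover_TT'_near` — the mechanism at the
  generality of `…_near` (any `t, t'`, any form factor `g`, grid cells indexed by an arbitrary type `ι`, every
  datum of the node indexed by the cell): SOME supporting slope within `Δ_i` of SOME grid point `μ'_i`
  ⇒ `liminf_k u_k ≤ B` for every `B ≥ (c_i − Δ_i C_{q,i} − A_i + (Σ_σ μ_{iσ})(n/2 − ν_i))²` (all `i`).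
* §2 `ObsPairLROCeilingAt_of_onePoint_chargedStationary_gridCells_bound_sq` — PRODUCER FORM (`t = 1`,
  `g = dWaveFormFactor`): a monotone grid `m : Fin (J+2) → ℝ` with `m 0 ≤ μ₋(n)`, `μ₊(n) ≤ m (Fin.last (J+1))`
  and, per cell `j : Fin (J+1)`, a grid point with `μ'_j − Δ_j ≤ m j.castSucc`, `m j.succ ≤ μ'_j + Δ_j`
  (finitely many rational inequalities), one grid-point node, one `hWq` ⇒ `ObsPairLROCeilingAt t' U n c'`
  at every `c' ≥ max_j (c_j − Δ_j C_{q,j} − A_j + (Σ_σ μ_{jσ})(n/2 − ν_j))²` (stated as `∀ j, … ≤ c'`).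
  Uses `exists_mem_Icc_castSucc_succ_of_monotone` (PairLROTowerChargedCells §1): closed cells, shared
  endpoints, a boundary slope is served by either neighbour.
* §3 `ObsPairLROCeilingAt_of_onePoint_chargedStationary_near_of_cover` — menu-3's (R5) wording: an
  arbitrary family of grid cells `[μ'_i − Δ_i, μ'_i + Δ_i]` whose union contains `[μ_lo, μ_hi] ⊇ [μ₋(n), μ₊(n)]`.
The one-cell case of each is `…_near` itself (read at `μ_c = μ₋(n)`); the `∀ μ_c ∈ cell` hypothesis form is
PairLROTowerChargedCells (`onePoint_chargedStationary_bound_of_gridNode` converts between the two).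

References: T. Koma, H. Tasaki, J. Stat. Phys. 76 (1994) 745, Theorem 5 [KomaTasaki1994]; D. Ruelle,
*Statistical Mechanics* (1969) §3.4 [Ruelle1969]; E. H. Lieb, F. Y. Wu, Physica A 321 (2003) 1, §7
[LiebWuPhysicaA2003]; W. Pusz, S. L. Woronowicz, Comm. Math. Phys. 58 (1978) 273, §1 [PuszWoronowicz1978].
-/

noncomputable section

namespace Summit.Ventures.CertifiedManyBodySolver.Observables

open Matrix Complex Finset Literature.MathematicalPhysics.QuantumLattice Literature.Probability.LatticeModels
open Literature.MathematicalPhysics.QuantumLattice.HubbardWave0 ThermodynamicLimit Filter Topology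
open Literature.MathematicalPhysics.QuantumManyBody.StateRelaxation
open scoped ComplexOrder ComplexConjugate BigOperators

/-! ### §1 The mechanism: a supporting slope within `Δ_i` of some grid point ⇒ `…_near` applies there -/

section GridCover

variable (g : Site 2 → ℝ)

/-- **OP1-C on a family of grid cells (general form).** Data of
`liminf_pairFieldLRO_le_sq_of_onePoint_chargedStationary_bound_TT'_near` (`U ≥ 0`, `0 < n < 2`) indexed
by a cell index `i : ι`: grid point `μ'_i`, half-width `Δ_i`, constants `c_i, A_i, κ_i ≥ 0,
u_i ≥ e(t,t',U,n), ν_i`, density multipliers `μ_i`, a local word `w_i ∈ 𝔄_{Λ_i}` with `w_i`, `w_iᴴ` even,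
its `N̂` double-commutator bounds `hDDN₁/₂` (constant `DN_i ≥ 0`), its one-point charge size `hWq`
(constant `C_{q,i}`), and the CHARGED one-point node of cell `i` with its rows written AT THE GRID POINT
`μ'_i` (`hboundC'`). If SOME supporting slope `μ_s ∈ [μ₋(n), μ₊(n)]` satisfies `|μ'_i − μ_s| ≤ Δ_i` for
SOME `i`, then every family of unit `(rectN n L, S^z=0)`-sector ground states has `liminf_k u_k ≤ B` for
every `B` with `(c_i − Δ_i C_{q,i} − A_i + (Σ_σ μ_{iσ})(n/2 − ν_i))² ≤ B` for all `i` — `…_near` applied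
in that cell. No finiteness, order or disjointness of the cells is used. [cite: KomaTasaki1994, Theorem 5]
[cite: PuszWoronowicz1978, §1] [cite: Ruelle1969, §3.4] -/
theorem liminf_pairFieldLRO_le_of_onePoint_chargedStationary_gridCover_TT'_near (t t' : ℝ) {U n : ℝ}
    (hU : 0 ≤ U) (hn0 : 0 < n) (hn2 : n < 2) {ι : Type*} (μ' Δ : ι → ℝ)
    (hcov : ∃ μs ∈ Set.Icc (chemPotMinusTT' t t' U n) (chemPotPlusTT' t t' U n), ∃ i : ι, |μ' i - μs| ≤ Δ i)
    (c A κ u ν Cq : ι → ℝ) (μ : ι → Fin 2 → ℝ) (hκ : ∀ i, 0 ≤ κ i)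
    (hu : ∀ i, energyDensityTT' t t' U n ≤ u i)
    {Λw : ι → Finset (Site 2)} (wloc : ∀ i, FermionOp (Λw i))
    (hweven : ∀ i, wloc i ∈ carEvenSubalgebra (Finset.univ : Finset (Orb (PolySite (Λw i)))))
    (hwevenH : ∀ i, (wloc i)ᴴ ∈ carEvenSubalgebra (Finset.univ : Finset (Orb (PolySite (Λw i))))) (L₁ : ℕ)
    (hInjw : ∀ i, ∀ L : ℕ, L₁ ≤ L → Set.InjOn (Torus.proj (d := 2) L) ↑(Λw i))
    (DN : ι → ℝ) (LN : ℕ) (hDN : ∀ i, 0 ≤ DN i)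
    (hDDN₁ : ∀ i, ∀ (L : ℕ) [NeZero L] (hL : L₁ ≤ L), LN ≤ L → ∀ χ : Fock (Orb (FermionTorus 2 L)),
      star χ ⬝ᵥ χ = 1 →
      |(star χ ⬝ᵥ (((∑ v : TorusSite 2 L, relabel (Orb.translate v)
          (fermionEmbed (PolySite.toTorusEmb L (hInjw i L hL)) (((1 / 2 : ℂ)) • (wloc i + (wloc i)ᴴ)))) *
        ((∑ v : TorusSite 2 L, relabel (Orb.translate v)
          (fermionEmbed (PolySite.toTorusEmb L (hInjw i L hL)) (((1 / 2 : ℂ)) • (wloc i + (wloc i)ᴴ)))) *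
            totalNumber -
          totalNumber * (∑ v : TorusSite 2 L, relabel (Orb.translate v)
          (fermionEmbed (PolySite.toTorusEmb L (hInjw i L hL)) (((1 / 2 : ℂ)) • (wloc i + (wloc i)ᴴ))))) -
        ((∑ v : TorusSite 2 L, relabel (Orb.translate v)
          (fermionEmbed (PolySite.toTorusEmb L (hInjw i L hL)) (((1 / 2 : ℂ)) • (wloc i + (wloc i)ᴴ)))) *
            totalNumber -
          totalNumber * (∑ v : TorusSite 2 L, relabel (Orb.translate v)
          (fermionEmbed (PolySite.toTorusEmb L (hInjw i L hL)) (((1 / 2 : ℂ)) • (wloc i + (wloc i)ᴴ))))) *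
        (∑ v : TorusSite 2 L, relabel (Orb.translate v)
          (fermionEmbed (PolySite.toTorusEmb L (hInjw i L hL)) (((1 / 2 : ℂ)) • (wloc i + (wloc i)ᴴ))))) *ᵥ
          χ)).re| ≤ DN i * (L : ℝ) ^ 2)
    (hDDN₂ : ∀ i, ∀ (L : ℕ) [NeZero L] (hL : L₁ ≤ L), LN ≤ L → ∀ χ : Fock (Orb (FermionTorus 2 L)),
      star χ ⬝ᵥ χ = 1 →
      |(star χ ⬝ᵥ (((∑ v : TorusSite 2 L, relabel (Orb.translate v)
          (fermionEmbed (PolySite.toTorusEmb L (hInjw i L hL)) ((I / 2 : ℂ) • ((wloc i)ᴴ - wloc i)))) *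
        ((∑ v : TorusSite 2 L, relabel (Orb.translate v)
          (fermionEmbed (PolySite.toTorusEmb L (hInjw i L hL)) ((I / 2 : ℂ) • ((wloc i)ᴴ - wloc i)))) *
            totalNumber -
          totalNumber * (∑ v : TorusSite 2 L, relabel (Orb.translate v)
          (fermionEmbed (PolySite.toTorusEmb L (hInjw i L hL)) ((I / 2 : ℂ) • ((wloc i)ᴴ - wloc i))))) -
        ((∑ v : TorusSite 2 L, relabel (Orb.translate v)
          (fermionEmbed (PolySite.toTorusEmb L (hInjw i L hL)) ((I / 2 : ℂ) • ((wloc i)ᴴ - wloc i)))) *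
            totalNumber -
          totalNumber * (∑ v : TorusSite 2 L, relabel (Orb.translate v)
          (fermionEmbed (PolySite.toTorusEmb L (hInjw i L hL)) ((I / 2 : ℂ) • ((wloc i)ᴴ - wloc i))))) *
        (∑ v : TorusSite 2 L, relabel (Orb.translate v)
          (fermionEmbed (PolySite.toTorusEmb L (hInjw i L hL)) ((I / 2 : ℂ) • ((wloc i)ᴴ - wloc i))))) *ᵥ
          χ)).re| ≤ DN i * (L : ℝ) ^ 2)
    -- the one-point size of the charge of `W_{i,L}`: `|Re⟨ζ,(N̂W − WN̂)ζ⟩| ≤ C_{q,i}·L²`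
    (hWq : ∀ i, ∀ (L : ℕ) [NeZero L] (hL : L₁ ≤ L) (ζ : Fock (Orb (FermionTorus 2 L))), star ζ ⬝ᵥ ζ = 1 →
      |(star ζ ⬝ᵥ ((totalNumber * (∑ v : TorusSite 2 L, relabel (Orb.translate v)
          (fermionEmbed (PolySite.toTorusEmb L (hInjw i L hL)) (wloc i))) -
        (∑ v : TorusSite 2 L, relabel (Orb.translate v)
          (fermionEmbed (PolySite.toTorusEmb L (hInjw i L hL)) (wloc i))) * totalNumber) *ᵥ ζ)).re| ≤
        Cq i * (L : ℝ) ^ 2)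
    -- the node of cell `i`, with its charged row at the GRID chemical potential `μ'_i`
    (hboundC' : ∀ i, ∀ (L : ℕ) [NeZero L] (hL : L₁ ≤ L) (ζ : Fock (Orb (FermionTorus 2 L))),
      star ζ ⬝ᵥ ζ = 1 →
      c i - A i + ∑ σ : Fin 2, μ i σ *
          ((star ζ ⬝ᵥ ((∑ y : FermionTorus 2 L, numberOp y σ) *ᵥ ζ)).re / (L : ℝ) ^ 2 - ν i) +
        κ i * (u i - (star ζ ⬝ᵥ (hubbardTorusTT' L t t' U *ᵥ ζ)).re / (L : ℝ) ^ 2) +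
        (star ζ ⬝ᵥ (((hubbardTorusTT' L t t' U - (μ' i : ℂ) • totalNumber) *
              (∑ v : TorusSite 2 L, relabel (Orb.translate v)
                (fermionEmbed (PolySite.toTorusEmb L (hInjw i L hL)) (wloc i))) -
            (∑ v : TorusSite 2 L, relabel (Orb.translate v)
                (fermionEmbed (PolySite.toTorusEmb L (hInjw i L hL)) (wloc i))) *
              (hubbardTorusTT' L t t' U - (μ' i : ℂ) • totalNumber)) *ᵥ ζ)).re / (L : ℝ) ^ 2 ≤
        -((expect (pairField g L) ζ).re / (L : ℝ) ^ 2))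
    {B : ℝ} (hB : ∀ i, (c i - Δ i * Cq i - A i + (∑ σ : Fin 2, μ i σ) * (n / 2 - ν i)) ^ 2 ≤ B)
    (ψ : ∀ L, Fock (Orb (FermionTorus 2 L)))
    (hψ : ∀ L, IsGroundStateInSector (hubbardTorusTT' L t t' U) (rectN n L) 0 (ψ L))
    (hψ1 : ∀ L, star (ψ L) ⬝ᵥ ψ L = 1) :
    liminf (fun k : ℕ => (∑ x ∈ halfOpenBox 2 (2 * k), ∑ y ∈ halfOpenBox 2 (2 * k),
        torusPullback (pairFieldCorr g ψ) (2 * k) x y) / ((#(halfOpenBox 2 (2 * k)) : ℝ)) ^ 2) atTop ≤ B := by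
  obtain ⟨μs, hμs, i, hi⟩ := hcov
  exact (liminf_pairFieldLRO_le_sq_of_onePoint_chargedStationary_bound_TT'_near g t t' hU hn0 hn2 (μ i)
    (hκ i) (hu i) hμs hi (wloc i) (hweven i) (hwevenH i) L₁ (hInjw i) LN (hDN i) (hDDN₁ i) (hDDN₂ i)
    (hWq i) (hboundC' i) ψ hψ hψ1).trans (hB i)

end GridCover

/-! ### §2 Producer form: a monotone grid of cells, one grid-point certificate per cell -/

section GridCells

variable {tp U n : ℝ}

/-- **OP1-C GRID-CELL CONSUMER (hubbard-obs RULINGS (eu) d187 «(A3)» / (ex4) d190 «(R5)»).** At the anchor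
`(U, n, t')`, `U ≥ 0`, `0 < n < 2`: a monotone grid `m : Fin (J+2) → ℝ` (`J+1 ≥ 1` closed cells
`[m j.castSucc, m j.succ]`) whose hull contains the certified bracket, `m 0 ≤ μ₋(n)` and
`μ₊(n) ≤ m (Fin.last (J+1))` (`chemPot_mem_cell_of_mem_Icc` and a comparison of rationals); per cell `j`
a grid point `μ'_j` and half-width `Δ_j` with `μ'_j − Δ_j ≤ m j.castSucc` and `m j.succ ≤ μ'_j + Δ_j`,
and the data of `liminf_pairFieldLRO_le_sq_of_onePoint_chargedStationary_bound_TT'_near` at `t = 1`,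
`g = dWaveFormFactor`: ONE certificate per cell with its charged rows at `μ'_j` (`hboundC'`), the charge
size `hWq` of its word (constant `C_{q,j}`), `hDDN₁/₂`, evenness. Conclusion: the leaf
`ObsPairLROCeilingAt t' U n c'` at every `c' ≥ max_j (c_j − Δ_j C_{q,j} − A_j + (Σ_σ μ_{jσ})(n/2 − ν_j))²`.
Proof: `μ₋(n)` lies in the hull, hence in some closed cell `j` (`exists_mem_Icc_castSucc_succ_of_monotone`;
a boundary slope is served by either neighbour), so `|μ'_j − μ₋(n)| ≤ Δ_j`, and §1 applies.
[cite: KomaTasaki1994, Theorem 5] [cite: Ruelle1969, §3.4] [cite: LiebWuPhysicaA2003, §7] -/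
theorem ObsPairLROCeilingAt_of_onePoint_chargedStationary_gridCells_bound_sq (hU : 0 ≤ U) (hn0 : 0 < n)
    (hn2 : n < 2) {J : ℕ} (m : Fin (J + 2) → ℝ) (hm : Monotone m)
    (hlo : m 0 ≤ chemPotMinusTT' 1 tp U n) (hhi : chemPotPlusTT' 1 tp U n ≤ m (Fin.last (J + 1)))
    (μ' Δ : Fin (J + 1) → ℝ) (hleft : ∀ j, μ' j - Δ j ≤ m j.castSucc) (hright : ∀ j, m j.succ ≤ μ' j + Δ j)
    (c A κ u ν Cq : Fin (J + 1) → ℝ) (μ : Fin (J + 1) → Fin 2 → ℝ) (hκ : ∀ j, 0 ≤ κ j)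
    (hu : ∀ j, energyDensityTT' 1 tp U n ≤ u j)
    {Λw : Fin (J + 1) → Finset (Site 2)} (wloc : ∀ j, FermionOp (Λw j))
    (hweven : ∀ j, wloc j ∈ carEvenSubalgebra (Finset.univ : Finset (Orb (PolySite (Λw j)))))
    (hwevenH : ∀ j, (wloc j)ᴴ ∈ carEvenSubalgebra (Finset.univ : Finset (Orb (PolySite (Λw j))))) (L₁ : ℕ)
    (hInjw : ∀ j, ∀ L : ℕ, L₁ ≤ L → Set.InjOn (Torus.proj (d := 2) L) ↑(Λw j))
    (DN : Fin (J + 1) → ℝ) (LN : ℕ) (hDN : ∀ j, 0 ≤ DN j)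
    (hDDN₁ : ∀ j, ∀ (L : ℕ) [NeZero L] (hL : L₁ ≤ L), LN ≤ L → ∀ χ : Fock (Orb (FermionTorus 2 L)),
      star χ ⬝ᵥ χ = 1 →
      |(star χ ⬝ᵥ (((∑ v : TorusSite 2 L, relabel (Orb.translate v)
          (fermionEmbed (PolySite.toTorusEmb L (hInjw j L hL)) (((1 / 2 : ℂ)) • (wloc j + (wloc j)ᴴ)))) *
        ((∑ v : TorusSite 2 L, relabel (Orb.translate v)
          (fermionEmbed (PolySite.toTorusEmb L (hInjw j L hL)) (((1 / 2 : ℂ)) • (wloc j + (wloc j)ᴴ)))) *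
            totalNumber -
          totalNumber * (∑ v : TorusSite 2 L, relabel (Orb.translate v)
          (fermionEmbed (PolySite.toTorusEmb L (hInjw j L hL)) (((1 / 2 : ℂ)) • (wloc j + (wloc j)ᴴ))))) -
        ((∑ v : TorusSite 2 L, relabel (Orb.translate v)
          (fermionEmbed (PolySite.toTorusEmb L (hInjw j L hL)) (((1 / 2 : ℂ)) • (wloc j + (wloc j)ᴴ)))) *
            totalNumber -
          totalNumber * (∑ v : TorusSite 2 L, relabel (Orb.translate v)
          (fermionEmbed (PolySite.toTorusEmb L (hInjw j L hL)) (((1 / 2 : ℂ)) • (wloc j + (wloc j)ᴴ))))) *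
        (∑ v : TorusSite 2 L, relabel (Orb.translate v)
          (fermionEmbed (PolySite.toTorusEmb L (hInjw j L hL)) (((1 / 2 : ℂ)) • (wloc j + (wloc j)ᴴ))))) *ᵥ
          χ)).re| ≤ DN j * (L : ℝ) ^ 2)
    (hDDN₂ : ∀ j, ∀ (L : ℕ) [NeZero L] (hL : L₁ ≤ L), LN ≤ L → ∀ χ : Fock (Orb (FermionTorus 2 L)),
      star χ ⬝ᵥ χ = 1 →
      |(star χ ⬝ᵥ (((∑ v : TorusSite 2 L, relabel (Orb.translate v)
          (fermionEmbed (PolySite.toTorusEmb L (hInjw j L hL)) ((I / 2 : ℂ) • ((wloc j)ᴴ - wloc j)))) *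
        ((∑ v : TorusSite 2 L, relabel (Orb.translate v)
          (fermionEmbed (PolySite.toTorusEmb L (hInjw j L hL)) ((I / 2 : ℂ) • ((wloc j)ᴴ - wloc j)))) *
            totalNumber -
          totalNumber * (∑ v : TorusSite 2 L, relabel (Orb.translate v)
          (fermionEmbed (PolySite.toTorusEmb L (hInjw j L hL)) ((I / 2 : ℂ) • ((wloc j)ᴴ - wloc j))))) -
        ((∑ v : TorusSite 2 L, relabel (Orb.translate v)
          (fermionEmbed (PolySite.toTorusEmb L (hInjw j L hL)) ((I / 2 : ℂ) • ((wloc j)ᴴ - wloc j)))) *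
            totalNumber -
          totalNumber * (∑ v : TorusSite 2 L, relabel (Orb.translate v)
          (fermionEmbed (PolySite.toTorusEmb L (hInjw j L hL)) ((I / 2 : ℂ) • ((wloc j)ᴴ - wloc j))))) *
        (∑ v : TorusSite 2 L, relabel (Orb.translate v)
          (fermionEmbed (PolySite.toTorusEmb L (hInjw j L hL)) ((I / 2 : ℂ) • ((wloc j)ᴴ - wloc j))))) *ᵥ
          χ)).re| ≤ DN j * (L : ℝ) ^ 2)
    (hWq : ∀ j, ∀ (L : ℕ) [NeZero L] (hL : L₁ ≤ L) (ζ : Fock (Orb (FermionTorus 2 L))), star ζ ⬝ᵥ ζ = 1 →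
      |(star ζ ⬝ᵥ ((totalNumber * (∑ v : TorusSite 2 L, relabel (Orb.translate v)
          (fermionEmbed (PolySite.toTorusEmb L (hInjw j L hL)) (wloc j))) -
        (∑ v : TorusSite 2 L, relabel (Orb.translate v)
          (fermionEmbed (PolySite.toTorusEmb L (hInjw j L hL)) (wloc j))) * totalNumber) *ᵥ ζ)).re| ≤
        Cq j * (L : ℝ) ^ 2)
    (hboundC' : ∀ j, ∀ (L : ℕ) [NeZero L] (hL : L₁ ≤ L) (ζ : Fock (Orb (FermionTorus 2 L))),
      star ζ ⬝ᵥ ζ = 1 →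
      c j - A j + ∑ σ : Fin 2, μ j σ *
          ((star ζ ⬝ᵥ ((∑ y : FermionTorus 2 L, numberOp y σ) *ᵥ ζ)).re / (L : ℝ) ^ 2 - ν j) +
        κ j * (u j - (star ζ ⬝ᵥ (hubbardTorusTT' L 1 tp U *ᵥ ζ)).re / (L : ℝ) ^ 2) +
        (star ζ ⬝ᵥ (((hubbardTorusTT' L 1 tp U - (μ' j : ℂ) • totalNumber) *
              (∑ v : TorusSite 2 L, relabel (Orb.translate v)
                (fermionEmbed (PolySite.toTorusEmb L (hInjw j L hL)) (wloc j))) -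
            (∑ v : TorusSite 2 L, relabel (Orb.translate v)
                (fermionEmbed (PolySite.toTorusEmb L (hInjw j L hL)) (wloc j))) *
              (hubbardTorusTT' L 1 tp U - (μ' j : ℂ) • totalNumber)) *ᵥ ζ)).re / (L : ℝ) ^ 2 ≤
        -((expect (pairField dWaveFormFactor L) ζ).re / (L : ℝ) ^ 2))
    {c' : ℚ} (hc' : ∀ j, (c j - Δ j * Cq j - A j + (∑ σ : Fin 2, μ j σ) * (n / 2 - ν j)) ^ 2 ≤ ((c' : ℚ) : ℝ)) :
    ObsPairLROCeilingAt tp U n c' := by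
  intro ψ hψ hψ1
  have hmp := chemPotMinusTT'_le_chemPotPlusTT' 1 tp hU hn0 hn2
  obtain ⟨j, hj⟩ := exists_mem_Icc_castSucc_succ_of_monotone hm
    (x := chemPotMinusTT' 1 tp U n) ⟨hlo, hmp.trans hhi⟩
  have hnear : |μ' j - chemPotMinusTT' 1 tp U n| ≤ Δ j :=
    abs_sub_le_iff.2 ⟨by linarith [hj.1, hleft j], by linarith [hj.2, hright j]⟩
  exact liminf_pairFieldLRO_le_of_onePoint_chargedStationary_gridCover_TT'_near dWaveFormFactor 1 tp hU hn0
    hn2 μ' Δ ⟨_, ⟨le_rfl, hmp⟩, j, hnear⟩ c A κ u ν Cq μ hκ hu wloc hweven hwevenH L₁ hInjw DN LN hDN hDDN₁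
    hDDN₂ hWq hboundC' hc' ψ hψ hψ1

/-! ### §3 The envelope sentence: any finite or infinite family of grid cells covering the bracket -/

/-- **OP1-C ENVELOPE (sr-mbsolver-menu-3 (R5) `…_near_of_cover`).** At the anchor `(U, n, t')`, `U ≥ 0`,
`0 < n < 2`: a bracket `μ_lo ≤ μ₋(n)`, `μ₊(n) ≤ μ_hi` (certified chords, `chemPot_mem_cell_of_mem_Icc`) and a
family of grid cells `[μ'_i − Δ_i, μ'_i + Δ_i]`, `i : ι`, whose union contains `[μ_lo, μ_hi]`, each with ONE
grid-point certificate (`hboundC'` at `μ'_i`, `t = 1`, `g = dWaveFormFactor`) and the charge size `hWq` of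
its word ⇒ `ObsPairLROCeilingAt t' U n c'` at every `c' ≥ sup_i (c_i − Δ_i C_{q,i} − A_i + (Σ_σ μ_{iσ})(n/2 − ν_i))²`.
[cite: KomaTasaki1994, Theorem 5] [cite: Ruelle1969, §3.4] [cite: LiebWuPhysicaA2003, §7] -/
theorem ObsPairLROCeilingAt_of_onePoint_chargedStationary_near_of_cover (hU : 0 ≤ U) (hn0 : 0 < n)
    (hn2 : n < 2) {μlo μhi : ℝ} (hlo : μlo ≤ chemPotMinusTT' 1 tp U n) (hhi : chemPotPlusTT' 1 tp U n ≤ μhi)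
    {ι : Type*} (μ' Δ : ι → ℝ) (hcover : Set.Icc μlo μhi ⊆ ⋃ i, Set.Icc (μ' i - Δ i) (μ' i + Δ i))
    (c A κ u ν Cq : ι → ℝ) (μ : ι → Fin 2 → ℝ) (hκ : ∀ i, 0 ≤ κ i)
    (hu : ∀ i, energyDensityTT' 1 tp U n ≤ u i)
    {Λw : ι → Finset (Site 2)} (wloc : ∀ i, FermionOp (Λw i))
    (hweven : ∀ i, wloc i ∈ carEvenSubalgebra (Finset.univ : Finset (Orb (PolySite (Λw i)))))
    (hwevenH : ∀ i, (wloc i)ᴴ ∈ carEvenSubalgebra (Finset.univ : Finset (Orb (PolySite (Λw i))))) (L₁ : ℕ)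
    (hInjw : ∀ i, ∀ L : ℕ, L₁ ≤ L → Set.InjOn (Torus.proj (d := 2) L) ↑(Λw i))
    (DN : ι → ℝ) (LN : ℕ) (hDN : ∀ i, 0 ≤ DN i)
    (hDDN₁ : ∀ i, ∀ (L : ℕ) [NeZero L] (hL : L₁ ≤ L), LN ≤ L → ∀ χ : Fock (Orb (FermionTorus 2 L)),
      star χ ⬝ᵥ χ = 1 →
      |(star χ ⬝ᵥ (((∑ v : TorusSite 2 L, relabel (Orb.translate v)
          (fermionEmbed (PolySite.toTorusEmb L (hInjw i L hL)) (((1 / 2 : ℂ)) • (wloc i + (wloc i)ᴴ)))) *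
        ((∑ v : TorusSite 2 L, relabel (Orb.translate v)
          (fermionEmbed (PolySite.toTorusEmb L (hInjw i L hL)) (((1 / 2 : ℂ)) • (wloc i + (wloc i)ᴴ)))) *
            totalNumber -
          totalNumber * (∑ v : TorusSite 2 L, relabel (Orb.translate v)
          (fermionEmbed (PolySite.toTorusEmb L (hInjw i L hL)) (((1 / 2 : ℂ)) • (wloc i + (wloc i)ᴴ))))) -
        ((∑ v : TorusSite 2 L, relabel (Orb.translate v)
          (fermionEmbed (PolySite.toTorusEmb L (hInjw i L hL)) (((1 / 2 : ℂ)) • (wloc i + (wloc i)ᴴ)))) *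
            totalNumber -
          totalNumber * (∑ v : TorusSite 2 L, relabel (Orb.translate v)
          (fermionEmbed (PolySite.toTorusEmb L (hInjw i L hL)) (((1 / 2 : ℂ)) • (wloc i + (wloc i)ᴴ))))) *
        (∑ v : TorusSite 2 L, relabel (Orb.translate v)
          (fermionEmbed (PolySite.toTorusEmb L (hInjw i L hL)) (((1 / 2 : ℂ)) • (wloc i + (wloc i)ᴴ))))) *ᵥ
          χ)).re| ≤ DN i * (L : ℝ) ^ 2)
    (hDDN₂ : ∀ i, ∀ (L : ℕ) [NeZero L] (hL : L₁ ≤ L), LN ≤ L → ∀ χ : Fock (Orb (FermionTorus 2 L)),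
      star χ ⬝ᵥ χ = 1 →
      |(star χ ⬝ᵥ (((∑ v : TorusSite 2 L, relabel (Orb.translate v)
          (fermionEmbed (PolySite.toTorusEmb L (hInjw i L hL)) ((I / 2 : ℂ) • ((wloc i)ᴴ - wloc i)))) *
        ((∑ v : TorusSite 2 L, relabel (Orb.translate v)
          (fermionEmbed (PolySite.toTorusEmb L (hInjw i L hL)) ((I / 2 : ℂ) • ((wloc i)ᴴ - wloc i)))) *
            totalNumber -
          totalNumber * (∑ v : TorusSite 2 L, relabel (Orb.translate v)
          (fermionEmbed (PolySite.toTorusEmb L (hInjw i L hL)) ((I / 2 : ℂ) • ((wloc i)ᴴ - wloc i))))) -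
        ((∑ v : TorusSite 2 L, relabel (Orb.translate v)
          (fermionEmbed (PolySite.toTorusEmb L (hInjw i L hL)) ((I / 2 : ℂ) • ((wloc i)ᴴ - wloc i)))) *
            totalNumber -
          totalNumber * (∑ v : TorusSite 2 L, relabel (Orb.translate v)
          (fermionEmbed (PolySite.toTorusEmb L (hInjw i L hL)) ((I / 2 : ℂ) • ((wloc i)ᴴ - wloc i))))) *
        (∑ v : TorusSite 2 L, relabel (Orb.translate v)
          (fermionEmbed (PolySite.toTorusEmb L (hInjw i L hL)) ((I / 2 : ℂ) • ((wloc i)ᴴ - wloc i))))) *ᵥ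
          χ)).re| ≤ DN i * (L : ℝ) ^ 2)
    (hWq : ∀ i, ∀ (L : ℕ) [NeZero L] (hL : L₁ ≤ L) (ζ : Fock (Orb (FermionTorus 2 L))), star ζ ⬝ᵥ ζ = 1 →
      |(star ζ ⬝ᵥ ((totalNumber * (∑ v : TorusSite 2 L, relabel (Orb.translate v)
          (fermionEmbed (PolySite.toTorusEmb L (hInjw i L hL)) (wloc i))) -
        (∑ v : TorusSite 2 L, relabel (Orb.translate v)
          (fermionEmbed (PolySite.toTorusEmb L (hInjw i L hL)) (wloc i))) * totalNumber) *ᵥ ζ)).re| ≤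
        Cq i * (L : ℝ) ^ 2)
    (hboundC' : ∀ i, ∀ (L : ℕ) [NeZero L] (hL : L₁ ≤ L) (ζ : Fock (Orb (FermionTorus 2 L))),
      star ζ ⬝ᵥ ζ = 1 →
      c i - A i + ∑ σ : Fin 2, μ i σ *
          ((star ζ ⬝ᵥ ((∑ y : FermionTorus 2 L, numberOp y σ) *ᵥ ζ)).re / (L : ℝ) ^ 2 - ν i) +
        κ i * (u i - (star ζ ⬝ᵥ (hubbardTorusTT' L 1 tp U *ᵥ ζ)).re / (L : ℝ) ^ 2) +
        (star ζ ⬝ᵥ (((hubbardTorusTT' L 1 tp U - (μ' i : ℂ) • totalNumber) *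
              (∑ v : TorusSite 2 L, relabel (Orb.translate v)
                (fermionEmbed (PolySite.toTorusEmb L (hInjw i L hL)) (wloc i))) -
            (∑ v : TorusSite 2 L, relabel (Orb.translate v)
                (fermionEmbed (PolySite.toTorusEmb L (hInjw i L hL)) (wloc i))) *
              (hubbardTorusTT' L 1 tp U - (μ' i : ℂ) • totalNumber)) *ᵥ ζ)).re / (L : ℝ) ^ 2 ≤
        -((expect (pairField dWaveFormFactor L) ζ).re / (L : ℝ) ^ 2))
    {c' : ℚ} (hc' : ∀ i, (c i - Δ i * Cq i - A i + (∑ σ : Fin 2, μ i σ) * (n / 2 - ν i)) ^ 2 ≤ ((c' : ℚ) : ℝ)) :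
    ObsPairLROCeilingAt tp U n c' := by
  intro ψ hψ hψ1
  have hmp := chemPotMinusTT'_le_chemPotPlusTT' 1 tp hU hn0 hn2
  obtain ⟨i, hi⟩ := Set.mem_iUnion.1 (hcover ⟨hlo, hmp.trans hhi⟩)
  have hnear : |μ' i - chemPotMinusTT' 1 tp U n| ≤ Δ i :=
    abs_sub_le_iff.2 ⟨by linarith [hi.1], by linarith [hi.2]⟩
  exact liminf_pairFieldLRO_le_of_onePoint_chargedStationary_gridCover_TT'_near dWaveFormFactor 1 tp hU hn0
    hn2 μ' Δ ⟨_, ⟨le_rfl, hmp⟩, i, hnear⟩ c A κ u ν Cq μ hκ hu wloc hweven hwevenH L₁ hInjw DN LN hDN hDDN₁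
    hDDN₂ hWq hboundC' hc' ψ hψ hψ1

end GridCells

end Summit.Ventures.CertifiedManyBodySolver.Observables

end
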